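import Summits.Schanuel.Schanuel.Theorems.SoloInformedBilinearFloor

/-!
# The monomial floor: algebraic monomials `e^q π^k` (soloist Proposition MF)

Soloist file (`solo-Schanuel-informed`, residency session s96, 2026-08-24), companion of
`SoloInformedBilinearFloor` (Proposition W, the ADDITIVE floor below `e ⟂ π`: the `ℚ`-linear
relations among `1, e, π, eπ` form a space of dimension `≤ 1`, so at most one of `e + π`, `eπ`,
`π/e` is rational).  This file types the MULTIPLICATIVE floor below `e ⟂ π`: the set
`L = {(q, k) ∈ ℤ² : e^q π^k ∈ ℚ̄}` of exponent vectors of ALGEBRAIC monomials in `e` and `π`.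
Nothing is deep; the point is the exact typing (atlas §1 F4, §2 E16 (ii) of the soloist's
statement, row r132).

## Statements

* §1 (unconditional).  `L` is a subgroup of `ℤ²` (`monomialAlgebraic_add`, `monomialAlgebraic_neg`)
  and any two of its elements are proportional (`monomialAlgebraic_det_eq_zero`: `q₁k₂ = q₂k₁`):
  if `e^{q₁}π^{k₁}` and `e^{q₂}π^{k₂}` are both algebraic then so is
  `(e^{q₁}π^{k₁})^{k₂} · ((e^{q₂}π^{k₂})^{k₁})⁻¹ = e^{q₁k₂ − q₂k₁}`, and `e^m ∈ ℚ̄` with `m ≠ 0`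
  makes `e` algebraic, contradicting Hermite (tree fact `transcendental_exp_one_holds`).  So the
  algebraic monomials lie on ONE line through the origin — which line, or whether it is `{0}`,
  is open (§2); `π` enters §1 only through `π ≠ 0`.  Instances: at most one of `eπ`, `e/π` is
  ALGEBRAIC (`transcendental_exp_mul_pi_or_exp_div_pi`); at most one of `eπ`, `e²π`
  (`transcendental_exp_mul_pi_or_exp_sq_mul_pi`); for each `k ≠ 0` at most one `q` with
  `e^q π^k ∈ ℚ̄` (`monomialAlgebraic_unique`).
* §2 (the open statement).  `MonomialFloor :⟺ e^q π^k` is transcendental for every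
  `(q, k) ≠ (0, 0)`, i.e. `L = 0`.  Its instance `(q, k) = (1, 1)`, the transcendence of `eπ`, is
  open — indeed the irrationality of `eπ` is (`expOneMulPiIrrational_of_monomialFloor`).
* §3 (summit side).  Monomials in an algebraically independent pair are transcendental
  (`transcendental_monomial_of_algebraicIndependent`: `y` is transcendental over `ℚ[x]` by
  Mathlib's `AlgebraicIndependent.transcendental_adjoin`, while an algebraic `x^q y^k` with
  `k ≠ 0` would make `y^k = (x^q)⁻¹ · (x^q y^k)` algebraic over `ℚ[x]`); hence
  `e ⟂ π ⟹ MonomialFloor` and `Schanuel ⟹ MonomialFloor`.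

## Reading (atlas §2 E16 (ii), r132)

Motivically each line `ℤ·(q, k) ⊂ ℤ²` is ONE rank-one exponential motive.  By [FresanJossen2020,
(1.1.4.1) p. 10; §12.2 pp. 260–262, Lemma 12.2.1, Prop. 12.2.3] the motive `M(√π) = H¹(𝔸¹, x²)`
has period `√π` and `M(√π)^{⊗2} ≅ H¹(s² + t² = 1)` is the Tate-type motive with period `π`
(up to `ℚ̄ˣ`), `E(b) = H⁰(Spec ℚ, b)` has period `e^{−b}`, and e.g. `H¹(𝔸¹, x² − 2x)` has the
single period `e√π` up to an algebraic factor; the exponential period conjecture for the rank-one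
motive `M(√π)^{⊗2k} ⊗ E(−q)` (motivic Galois group `𝔾_m`) reads "`e^q π^k ∉ ℚ̄`".  So, unlike
Grothendieck's period conjecture (whose rank-one case over `ℚ` is Lindemann's `2πi ∉ ℚ̄`), the
EXPONENTIAL period conjecture over `ℚ` is open already in rank one, and the `e ⟂ π` complex
enters the motivic ladder one rung BELOW the rank-two sum `ℚ(−1) ⊕ E(1)` (whose period
conjecture is `e ⟂ π`, atlas E16 (ii)): at the tensor line, where a product of an `E`-period
and a classical period must be shown transcendental, and no engine in print evaluates such a
product (soloist SHARPEST §2 M5, M8).  §1 is the unconditional content of that sector: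
`rank L ≤ 1`, by Hermite alone.

## References

* [FresanJossen2020] J. Fresán, P. Jossen, *Exponential motives*, book manuscript,
  (1.1.4.1) p. 10 and §12.2 pp. 260–262 (the motive `M(√π)`).
* [Angell2021] D. Angell, *Irrationality and Transcendence in Number Theory*, CRC Press 2022,
  Ch. 1 §1.4 (`e + π`, `eπ`: "at least one must be irrational …").
* [BakerTNT1975] A. Baker, *Transcendental Number Theory*, Cambridge Univ. Press 1975, Ch. 1
  Thm. 1.2 (Hermite), Ch. 12 §1.
-/

noncomputable section

open Literature.NumberTheory.Transcendental (ExpOnePiAlgebraicIndependent SchanuelRank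
  ExpOneMulPiIrrational transcendental_exp_one_holds)

namespace Summit.Schanuel.Schanuel.Theorems

/-! ### §0 Algebraicity under integer powers -/

section ZPow

variable {R A : Type*} [CommRing R] [Field A] [Algebra R A]

/-- Integer powers of an algebraic element of a field are algebraic. -/
theorem isAlgebraic_zpow [NoZeroDivisors R] {x : A} (h : IsAlgebraic R x) (m : ℤ) :
    IsAlgebraic R (x ^ m) := by
  cases m with
  | ofNat n => rw [Int.ofNat_eq_natCast, zpow_natCast]; exact h.pow n
  | negSucc n => rw [zpow_negSucc]; exact (h.pow _).inv

/-- If a non-zero integer power of `x` is algebraic then so is `x`. -/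
theorem isAlgebraic_of_zpow {x : A} {m : ℤ} (hm : m ≠ 0) (h : IsAlgebraic R (x ^ m)) :
    IsAlgebraic R x := by
  cases m with
  | ofNat n =>
    rw [Int.ofNat_eq_natCast, zpow_natCast] at h
    exact h.of_pow (Nat.pos_of_ne_zero (by rintro rfl; exact hm rfl))
  | negSucc n =>
    rw [zpow_negSucc, IsAlgebraic.inv_iff] at h
    exact h.of_pow n.succ_pos

/-- A non-zero integer power of a transcendental element is transcendental. -/
theorem transcendental_zpow {x : A} (h : Transcendental R x) {m : ℤ} (hm : m ≠ 0) :
    Transcendental R (x ^ m) :=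
  fun halg => h (isAlgebraic_of_zpow hm halg)

end ZPow

/-! ### §1 The algebraic monomials `e^q π^k` lie on one line (unconditional) -/

/-- `e^m` is transcendental for every integer `m ≠ 0` (Hermite). -/
theorem transcendental_exp_one_zpow {m : ℤ} (hm : m ≠ 0) : Transcendental ℚ (Real.exp 1 ^ m) :=
  transcendental_zpow transcendental_exp_one_holds hm

/-- Exponent bookkeeping: `(e^{q₁}π^{k₁})^{k₂} · ((e^{q₂}π^{k₂})^{k₁})⁻¹ = e^{q₁k₂ − q₂k₁}`. -/
theorem monomial_zpow_mul_zpow_inv (q₁ k₁ q₂ k₂ : ℤ) :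
    (Real.exp 1 ^ q₁ * Real.pi ^ k₁) ^ k₂ * ((Real.exp 1 ^ q₂ * Real.pi ^ k₂) ^ k₁)⁻¹ =
      Real.exp 1 ^ (q₁ * k₂ - q₂ * k₁) := by
  have hc : Real.pi ^ (k₁ * k₂) ≠ 0 := zpow_ne_zero _ Real.pi_ne_zero
  rw [mul_zpow, mul_zpow, ← zpow_mul, ← zpow_mul, ← zpow_mul, ← zpow_mul, mul_comm k₂ k₁,
    mul_inv, mul_mul_mul_comm, mul_inv_cancel₀ hc, mul_one, zpow_sub₀ (Real.exp_pos 1).ne',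
    div_eq_mul_inv]

/-- The algebraic monomials are closed under multiplication … -/
theorem monomialAlgebraic_add {q₁ k₁ q₂ k₂ : ℤ}
    (h₁ : IsAlgebraic ℚ (Real.exp 1 ^ q₁ * Real.pi ^ k₁))
    (h₂ : IsAlgebraic ℚ (Real.exp 1 ^ q₂ * Real.pi ^ k₂)) :
    IsAlgebraic ℚ (Real.exp 1 ^ (q₁ + q₂) * Real.pi ^ (k₁ + k₂)) := by
  rw [zpow_add₀ (Real.exp_pos 1).ne', zpow_add₀ Real.pi_ne_zero, mul_mul_mul_comm]
  exact h₁.mul h₂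

/-- … and under inversion: `L = {(q, k) : e^q π^k ∈ ℚ̄}` is a subgroup of `ℤ²`. -/
theorem monomialAlgebraic_neg {q k : ℤ} (h : IsAlgebraic ℚ (Real.exp 1 ^ q * Real.pi ^ k)) :
    IsAlgebraic ℚ (Real.exp 1 ^ (-q) * Real.pi ^ (-k)) := by
  rw [zpow_neg, zpow_neg, ← mul_inv]
  exact h.inv

/-- **Any two algebraic monomials `e^{q₁}π^{k₁}`, `e^{q₂}π^{k₂}` are proportional:
`q₁k₂ = q₂k₁`** — otherwise the quotient monomial `e^{q₁k₂ − q₂k₁}` is algebraic with a non-zero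
exponent, contradicting Hermite.  Unconditionally, then, the subgroup `L ⊂ ℤ²` of algebraic
monomials has rank `≤ 1`: it lies on a single line through `0`; which line, or whether
`L = 0` (§2), is open. -/
theorem monomialAlgebraic_det_eq_zero {q₁ k₁ q₂ k₂ : ℤ}
    (h₁ : IsAlgebraic ℚ (Real.exp 1 ^ q₁ * Real.pi ^ k₁))
    (h₂ : IsAlgebraic ℚ (Real.exp 1 ^ q₂ * Real.pi ^ k₂)) : q₁ * k₂ = q₂ * k₁ := by
  by_contra hne
  have halg : IsAlgebraic ℚ (Real.exp 1 ^ (q₁ * k₂ - q₂ * k₁)) := by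
    rw [← monomial_zpow_mul_zpow_inv]
    exact (isAlgebraic_zpow h₁ k₂).mul (isAlgebraic_zpow h₂ k₁).inv
  exact transcendental_exp_one_zpow (sub_ne_zero.mpr hne) halg

/-- For each `k ≠ 0` at most one exponent `q` makes `e^q π^k` algebraic. -/
theorem monomialAlgebraic_unique {q₁ q₂ k : ℤ} (hk : k ≠ 0)
    (h₁ : IsAlgebraic ℚ (Real.exp 1 ^ q₁ * Real.pi ^ k))
    (h₂ : IsAlgebraic ℚ (Real.exp 1 ^ q₂ * Real.pi ^ k)) : q₁ = q₂ :=
  mul_right_cancel₀ hk (monomialAlgebraic_det_eq_zero h₁ h₂)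

/-- **At most one of `eπ`, `e/π` is algebraic** (the exponent vectors `(1, 1)`, `(1, −1)` are
not proportional).  Compare `SoloInformedBilinearFloor.atMostOne_rational_add_mul_div`: at most one
of `e + π`, `eπ`, `π/e` is RATIONAL. -/
theorem transcendental_exp_mul_pi_or_exp_div_pi :
    Transcendental ℚ (Real.exp 1 * Real.pi) ∨ Transcendental ℚ (Real.exp 1 / Real.pi) := by
  by_contra h
  simp only [not_or, Transcendental, not_not] at h
  have h₁ : IsAlgebraic ℚ (Real.exp 1 ^ (1 : ℤ) * Real.pi ^ (1 : ℤ)) := by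
    simpa only [zpow_one] using h.1
  have h₂ : IsAlgebraic ℚ (Real.exp 1 ^ (1 : ℤ) * Real.pi ^ (-1 : ℤ)) := by
    simpa only [zpow_neg, zpow_one, div_eq_mul_inv] using h.2
  have := monomialAlgebraic_det_eq_zero h₁ h₂
  norm_num at this

/-- **At most one of `eπ`, `e²π` is algebraic** (exponent vectors `(1, 1)`, `(2, 1)`). -/
theorem transcendental_exp_mul_pi_or_exp_sq_mul_pi :
    Transcendental ℚ (Real.exp 1 * Real.pi) ∨ Transcendental ℚ (Real.exp 1 ^ 2 * Real.pi) := by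
  by_contra h
  simp only [not_or, Transcendental, not_not] at h
  have h₁ : IsAlgebraic ℚ (Real.exp 1 ^ (1 : ℤ) * Real.pi ^ (1 : ℤ)) := by
    simpa only [zpow_one] using h.1
  have h₂ : IsAlgebraic ℚ (Real.exp 1 ^ (2 : ℤ) * Real.pi ^ (1 : ℤ)) := by
    simpa only [zpow_ofNat, zpow_one, pow_one] using h.2
  have := monomialAlgebraic_det_eq_zero h₁ h₂
  norm_num at this

/-! ### §2 The open statement: the monomial floor -/

/-- OPEN — **the monomial floor below `e ⟂ π`**: every non-trivial monomial `e^q π^k`,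
`(q, k) ∈ ℤ² ∖ {0}`, is transcendental; equivalently (§1) the rank-`≤ 1` subgroup of algebraic
monomials is `0`.  It is the toric truncation of the algebraic independence of `e` and `π` —
motivically the exponential period conjecture for the rank-one exponential motives
`M(√π)^{⊗2k} ⊗ E(−q)` [cite: FresanJossen2020, §12.2 pp. 260–262 (the motive `M(√π)`,
Lemma 12.2.1, Prop. 12.2.3)] — and its instance `(1, 1)` contains the open irrationality of `eπ`
[cite: Angell2021, Ch. 1 §1.4 ("most likely, both are irrational, this has not been proved for
either one individually")]. -/
@[conjecture] def MonomialFloor : Prop :=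
  ∀ q k : ℤ, (q, k) ≠ (0, 0) → Transcendental ℚ (Real.exp 1 ^ q * Real.pi ^ k)

/-- `MonomialFloor ⟺` the only algebraic monomial `e^q π^k` is `e^0 π^0 = 1`. -/
theorem monomialFloor_iff :
    MonomialFloor ↔ ∀ q k : ℤ, IsAlgebraic ℚ (Real.exp 1 ^ q * Real.pi ^ k) → q = 0 ∧ k = 0 := by
  constructor
  · intro h q k halg
    by_contra hqk
    exact h q k (by rwa [ne_eq, Prod.mk.injEq]) halg
  · intro h q k hqk halg
    exact hqk (by rw [Prod.mk.injEq]; exact h q k halg)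

/-- The monomial floor contains the (open) irrationality of `eπ`. -/
theorem expOneMulPiIrrational_of_monomialFloor (h : MonomialFloor) : ExpOneMulPiIrrational := by
  have ht : Transcendental ℚ (Real.exp 1 ^ (1 : ℤ) * Real.pi ^ (1 : ℤ)) := h 1 1 (by simp)
  rw [zpow_one, zpow_one] at ht
  exact ht.irrational

/-! ### §3 The summit side: `e ⟂ π` gives the floor -/

/-- **Monomials in an algebraically independent pair are transcendental**: if `x, y ∈ ℝ` are
algebraically independent over `ℚ` then `x^q y^k ∉ ℚ̄` for every `(q, k) ≠ (0, 0)`.  (`y` is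
transcendental over `ℚ[x]`; an algebraic `x^q y^k` with `k ≠ 0` would make
`y^k = (x^q)⁻¹ (x^q y^k)` algebraic over `ℚ[x]`.) -/
theorem transcendental_monomial_of_algebraicIndependent {x y : ℝ}
    (hx : AlgebraicIndependent ℚ ![x, y]) {q k : ℤ} (hqk : (q, k) ≠ (0, 0)) :
    Transcendental ℚ (x ^ q * y ^ k) := by
  intro halg
  have hx0 : Transcendental ℚ x := by simpa using hx.transcendental 0
  by_cases hk : k = 0
  · subst hk
    have hq : q ≠ 0 := fun hq => hqk (by rw [hq])
    rw [zpow_zero, mul_one] at halg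
    exact hx0 (isAlgebraic_of_zpow hq halg)
  · have hxne : x ≠ 0 := by rintro rfl; exact hx0 isAlgebraic_zero
    have hyK := hx.transcendental_adjoin (s := ({0} : Set (Fin 2))) (i := 1) (by simp)
    set K : Subalgebra ℚ ℝ := Algebra.adjoin ℚ (![x, y] '' ({0} : Set (Fin 2))) with hK
    have hyK' : Transcendental K y := by simpa using hyK
    have hxK : IsAlgebraic K x := by
      have hmem : x ∈ K := Algebra.subset_adjoin ⟨0, Set.mem_singleton _, rfl⟩
      exact isAlgebraic_algebraMap (R := K) (A := ℝ) ⟨x, hmem⟩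
    have halgK : IsAlgebraic K (x ^ q * y ^ k) := halg.extendScalars (algebraMap ℚ K).injective
    have hykK : IsAlgebraic K (y ^ k) := by
      rw [← inv_mul_cancel_left₀ (zpow_ne_zero q hxne) (y ^ k)]
      exact (isAlgebraic_zpow hxK q).inv.mul halgK
    exact hyK' (isAlgebraic_of_zpow hk hykK)

/-- **`e ⟂ π ⟹` the monomial floor.** -/
theorem monomialFloor_of_expOnePiAlgebraicIndependent (h : ExpOnePiAlgebraicIndependent) :
    MonomialFloor := by
  intro q k hqk
  exact transcendental_monomial_of_algebraicIndependent h hqk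

/-- **The summit (already its rank-two case) gives the monomial floor.** -/
theorem monomialFloor_of_schanuel (h : _root_.Schanuel) : MonomialFloor :=
  monomialFloor_of_expOnePiAlgebraicIndependent
    (expOnePiAlgebraicIndependent_of_schanuelRank_two (h 2))

end Summit.Schanuel.Schanuel.Theorems

end
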